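import Summits.BirchSwinnertonDyer.BirchSwinnertonDyer.Theorems.ManinLocalTwoThreePinningFourHundredStagesC
import HarnessLib

/-!
# Level 400 by the PINNING KERNEL IN `S₂` — staged sieve certificates (part 10 of 11)

Cell `bsd-f2-manin`, route `ManinLocalTwoThree`, crux C2 `ManinOddAtFour` (stmt-BirchSwinnertonDyer-22967), an g57 (pipeline of an g56);
`--supports stmt-BirchSwinnertonDyer-22967` (helper).  The kernel certificates `hst6c9` … `hst6` (stage 6) of the staged box sieve
of level 400 (stage `k` maps the live list `L_k` of `…PinningFourHundredTables` into `L_{k+1}`; large stages in chunks of at most `EXTCAP = 160` extensions (`3·EXTCAP/(4·r)` at a stage with `r ≥ 2` relations),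
glued by part D's `sieveStep_subset_of_chunks`), split off the main file so that every file stays inside the farm's per-file
budget (depth `K = 192`: at `2⁴·5² ∣ N` every column divisible by `2` or `5` is dead; the certified column relations start at `p = 7` (columns `147 = 3·7²`, `189 = 3³·7`), so the sieve needs depth `192` and the `p = 17` stage still extends `36 × 17 = 612` assignments against two relations; the kernel keeps every intermediate of one `decide` alive, so each chunk is capped at ≈ 12 000 (extensions × relation length) (~2.6·10⁵ relation-term evaluations in all)).  the last part `…PinningFourHundred` has the duals, the cover `hcover` (from `hst0 … hst6`), the Fricke sieve, `dim S₂` and the pinning theorems.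
HONEST FRAMING: kernel-checked evaluations of integer lists only; nothing here proves C2/C3, Manin's conjecture or BSD.
[cite: CremonaAlgorithms1997, §2.10] [cite: Koehler2011, §2.1]
-/


set_option autoImplicit false
-- lint-debt: the directory name repeats the summit name (sibling precedent `ManinLocalTwoThreePinningSixtyThree.lean`)
set_option linter.dupNamespace false

noncomputable section


open Complex
open UpperHalfPlane hiding I
open scoped MatrixGroups ModularForm
open ModularForm CongruenceSubgroup
open Literature.NumberTheory.ModularForms
open Literature.NumberTheory.EllipticCurves Literature.NumberTheory.EllipticCurves.ModularForms

namespace Summit.BirchSwinnertonDyer.BirchSwinnertonDyer.Theorems.ManinLocalTwoThree.PinningFourHundred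

open Summit.BirchSwinnertonDyer.BirchSwinnertonDyer.Theorems.ManinLocalTwoThree.BracketSturm
open Summit.BirchSwinnertonDyer.BirchSwinnertonDyer.Theorems.ManinLocalTwoThree.PinningKernel


set_option maxHeartbeats 4000000
set_option maxRecDepth 16384

/-! ## §2d-4 Sieve certificates `hst6c9` … `hst6` (stage 6) -/

/-- Sieve stage `6`, chunk `9` (kernel `decide`). [folklore] -/
theorem hst6c9 : ∀ σ ∈ sieveStep 400 192 (chunks6.getD 9 []) (stages.getD 6 (0, [])), σ ∈ lvs.getD 6 [] := by decide +kernel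
/-- Sieve stage `6`, chunk `10` (kernel `decide`). [folklore] -/
theorem hst6c10 : ∀ σ ∈ sieveStep 400 192 (chunks6.getD 10 []) (stages.getD 6 (0, [])), σ ∈ lvs.getD 6 [] := by decide +kernel
/-- Sieve stage `6`, chunk `11` (kernel `decide`). [folklore] -/
theorem hst6c11 : ∀ σ ∈ sieveStep 400 192 (chunks6.getD 11 []) (stages.getD 6 (0, [])), σ ∈ lvs.getD 6 [] := by decide +kernel
/-- Sieve stage `6`, chunk `12` (kernel `decide`). [folklore] -/
theorem hst6c12 : ∀ σ ∈ sieveStep 400 192 (chunks6.getD 12 []) (stages.getD 6 (0, [])), σ ∈ lvs.getD 6 [] := by decide +kernel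
/-- Sieve stage `6`, chunk `13` (kernel `decide`). [folklore] -/
theorem hst6c13 : ∀ σ ∈ sieveStep 400 192 (chunks6.getD 13 []) (stages.getD 6 (0, [])), σ ∈ lvs.getD 6 [] := by decide +kernel
/-- Sieve stage `6`, chunk `14` (kernel `decide`). [folklore] -/
theorem hst6c14 : ∀ σ ∈ sieveStep 400 192 (chunks6.getD 14 []) (stages.getD 6 (0, [])), σ ∈ lvs.getD 6 [] := by decide +kernel
/-- Sieve stage `6`, chunk `15` (kernel `decide`). [folklore] -/
theorem hst6c15 : ∀ σ ∈ sieveStep 400 192 (chunks6.getD 15 []) (stages.getD 6 (0, [])), σ ∈ lvs.getD 6 [] := by decide +kernel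
/-- Sieve stage `6`, chunk `16` (kernel `decide`). [folklore] -/
theorem hst6c16 : ∀ σ ∈ sieveStep 400 192 (chunks6.getD 16 []) (stages.getD 6 (0, [])), σ ∈ lvs.getD 6 [] := by decide +kernel
/-- Sieve stage `6`, chunk `17` (kernel `decide`). [folklore] -/
theorem hst6c17 : ∀ σ ∈ sieveStep 400 192 (chunks6.getD 17 []) (stages.getD 6 (0, [])), σ ∈ lvs.getD 6 [] := by decide +kernel
/-- Sieve stage `6`: the live list `L_6` is mapped into `L_7` (kernel `decide`). [folklore] -/
theorem hst6 : ∀ σ ∈ sieveStep 400 192 ((([[]] : List (List (ℕ × ℤ))) :: lvs).getD 6 []) (stages.getD 6 (0, [])), σ ∈ lvs.getD 6 [] :=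
  sieveStep_subset_of_chunks 400 192 chunks6 (by decide +kernel) fun j hj ↦ by
    have hj' : j < 18 := lt_of_lt_of_eq hj (by decide)
    interval_cases j
    exacts [hst6c0, hst6c1, hst6c2, hst6c3, hst6c4, hst6c5, hst6c6, hst6c7, hst6c8, hst6c9, hst6c10, hst6c11, hst6c12, hst6c13, hst6c14, hst6c15, hst6c16, hst6c17]

end Summit.BirchSwinnertonDyer.BirchSwinnertonDyer.Theorems.ManinLocalTwoThree.PinningFourHundred

end
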